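import Literature.MathematicalPhysics.QuantumFieldTheory.Balaban1983to89.B2

/-!
# `Balaban1983to89.B1StoppingScale366` — T. Bałaban, *(Higgs)₂,₃ quantum fields in a finite volume. I. A lower bound*,
Commun. Math. Phys. **85** (1982) 603–626 [Balaban1982Higgs1] p. 624 (the sentence before (3.66)) and p. 604 ((1.2)):
the STOPPING SCALE `K` of the renormalization procedure — *"We take K such that L^Kε ≦ ε₀, but L^{K+1}ε > ε₀"* —
EXISTS and is UNIQUE for every `0 < ε ≦ ε₀` and `L > 1`, and `K = O(log ε^{−1})` with the explicit bracket
`log(ε₀/ε)/log L − 1 < K ≦ log(ε₀/ε)/log L`; the same rule is [Balaban1982Higgs2] (2.116) p. 582 (`B2.Run.StopsAt`);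
theorems only

statement-level skeleton of published theorems with citation tags; proofs where landed; nothing here is a claim about the Yang–Mills mass gap

PDF held: `paper:balaban1982-cmp85-higgs23-i` (journal page = PDF page + 602); p. 624 [PDF 22] and p. 604 [PDF 2] read AS
IMAGES on the ×4 renders `run/shared/lean/pub/pub-balaban/b2b-balaban-ref1/pages/1982-cmp85-higgs23-I/
1982-cmp85-higgs23-I-p022-x4.png`, `…-p002-x4.png`; [Balaban1982Higgs2] p. 582 [PDF 28] (`paper:balaban1982-cmp86-higgs23-ii`).

CITATION HEADER (lean-in-tree rule) — WHAT IS REPRODUCED.  Cell `lit-balaban` (HOME `run/shared/lean/pub/lit-balaban/`),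
unit `lit-balaban-r14` gen 6 (literature-prover-lit-balaban-r14-g6-0; B1 fold owner), own-lineage free target
(PHASE2-TARGETS §G.5-34(d); TAKING line HOME/STATUS.md 2026-08-21T07:16:25Z).  SKELETON rows served: **B1.Eq3.66**
(the stopping-scale sentence, so far `typed-existing` as the PREDICATE `B2.Run.StopsAt` of the b2b file `…B2` — here
its existence/uniqueness/size CONTENT is proved), **B1.Eq1.2** (member *"K = O(log ε^{−1})"*) and **B2.Eq2.116**
(the same rule in part II; owner r02).  NO decl of record is restated; `B2.Run.StopsAt` is consumed BY NAME in §3.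
THE SOURCE TEXT, verbatim.  B1 p. 624 [PDF 22]: *"Now we can finish the proof of the lower bound. We take K such that
L^Kε ≦ ε₀, but L^{K+1}ε > ε₀, and then we have (3.26)–(3.32) with k = K."*; B1 p. 604 [PDF 2], after (1.2): *"where
K, L, M, L′_μ are some positive integers, K = O(log ε^{−1}) and L, M will be described later"*; B2 p. 582 [PDF 28]:
*"The procedure is continued until k = K, where K is such that L^Kε ≦ ε₀, L^{K+1}ε > ε₀."*

WHAT THIS FILE PROVES (0 sorry; axioms ⊆ {propext, Classical.choice, Quot.sound}; theorems only, no new `def`).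
§1 `exists_stoppingScale` (for `1 < L`, `0 < ε ≤ ε₀` there is `K : ℕ` with `L^Kε ≤ ε₀ < L^{K+1}ε`; Mathlib's
   `exists_nat_pow_near` at `x = ε₀/ε`), `stoppingScale_unique` (two such `K` coincide), `existsUnique_stoppingScale`.
§2 the size: `stoppingScale_le_log` (`K ≤ log(ε₀/ε)/log L`), `log_lt_stoppingScale_succ` (`log(ε₀/ε)/log L < K + 1`),
   `stoppingScale_le_log_inv` (`ε₀ ≤ 1 ⇒ K ≤ log(ε^{−1})/log L` — the printed *"K = O(log ε^{−1})"* with the constant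
   `1/log L`).
§3 the same for the b2b predicate `B2.Run.StopsAt P ε₀ ρ` ((2.116)): `stopsAt_iff`, `exists_stopsAt` (for any run
   template `ρ` with `0 < ρ.ε ≤ ε₀` some `K` makes `{ρ with K := K}` stop), `stopsAt_unique`, `stopsAt_le_log`.
HONEST SCOPE.  Elementary real analysis; the only content is that the printed rule determines `K` and that `K` grows
like `log ε^{−1}` — nothing about what is done at the scales `k ≤ K`.  `ε₀` is the fixed *"sufficiently small"* unit
scale of the papers (B1 p. 617, B2 p. 582); `ε ≤ ε₀` is the papers' standing regime (for `ε > ε₀` no `K ≥ 0` exists and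
nothing is claimed).  Value = a small kernel certificate closing the definitional content of row B1.Eq3.66; NOT summit
progress.  Unit `lit-balaban-r14` gen 6; HOME/FILED.md records the proposal.
-/

namespace Literature.MathematicalPhysics.QuantumFieldTheory.Balaban1983to89.B1StoppingScale366

/-! ## §1 Existence and uniqueness of the stopping scale -/

section Real

/-- **The stopping scale exists**: for `L > 1` and `0 < ε ≤ ε₀` there is `K` with `L^Kε ≤ ε₀ < L^{K+1}ε`
(p. 624: *"We take K such that L^Kε ≦ ε₀, but L^{K+1}ε > ε₀"*). PROVED. [cite: Balaban1982Higgs1, (3.66) p.624] -/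
theorem exists_stoppingScale {L ε ε₀ : ℝ} (hL : 1 < L) (hε : 0 < ε) (hεε₀ : ε ≤ ε₀) :
    ∃ K : ℕ, L ^ K * ε ≤ ε₀ ∧ ε₀ < L ^ (K + 1) * ε := by
  have hx : 1 ≤ ε₀ / ε := by rwa [le_div_iff₀ hε, one_mul]
  obtain ⟨K, h1, h2⟩ := exists_nat_pow_near hx hL
  refine ⟨K, ?_, ?_⟩
  · exact (le_div_iff₀ hε).mp h1
  · exact (div_lt_iff₀ hε).mp h2

/-- **The stopping scale is unique**: `L^Kε ≤ ε₀ < L^{K+1}ε` and `L^{K′}ε ≤ ε₀ < L^{K′+1}ε` force `K = K′` (`L > 1`,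
`ε > 0`). PROVED. [cite: Balaban1982Higgs1, (3.66) p.624] -/
theorem stoppingScale_unique {L ε ε₀ : ℝ} (hL : 1 < L) (hε : 0 < ε) {K K' : ℕ}
    (hK : L ^ K * ε ≤ ε₀ ∧ ε₀ < L ^ (K + 1) * ε) (hK' : L ^ K' * ε ≤ ε₀ ∧ ε₀ < L ^ (K' + 1) * ε) : K = K' := by
  have h1 : L ^ K < L ^ (K' + 1) := lt_of_mul_lt_mul_right (hK.1.trans_lt hK'.2) hε.le
  have h2 : L ^ K' < L ^ (K + 1) := lt_of_mul_lt_mul_right (hK'.1.trans_lt hK.2) hε.le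
  have h1' : K < K' + 1 := (pow_lt_pow_iff_right₀ hL).mp h1
  have h2' : K' < K + 1 := (pow_lt_pow_iff_right₀ hL).mp h2
  omega

/-- Existence and uniqueness together: the printed rule DETERMINES `K`. [cite: Balaban1982Higgs1, (3.66) p.624] -/
theorem existsUnique_stoppingScale {L ε ε₀ : ℝ} (hL : 1 < L) (hε : 0 < ε) (hεε₀ : ε ≤ ε₀) :
    ∃! K : ℕ, L ^ K * ε ≤ ε₀ ∧ ε₀ < L ^ (K + 1) * ε := by
  obtain ⟨K, hK⟩ := exists_stoppingScale hL hε hεε₀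
  exact ⟨K, hK, fun K' hK' => stoppingScale_unique hL hε hK' hK⟩

/-! ## §2 `K = O(log ε^{−1})` ((1.2) p. 604) -/

/-- **`K ≤ log(ε₀/ε)/log L`** from `L^Kε ≤ ε₀` (`L > 1`, `ε > 0`). PROVED. [cite: Balaban1982Higgs1, (1.2) p.604] -/
theorem stoppingScale_le_log {L ε ε₀ : ℝ} (hL : 1 < L) (hε : 0 < ε) {K : ℕ} (hK : L ^ K * ε ≤ ε₀) :
    (K : ℝ) ≤ Real.log (ε₀ / ε) / Real.log L := by
  have hlogL : 0 < Real.log L := Real.log_pos hL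
  have hLK : 0 < L ^ K := pow_pos (zero_lt_one.trans hL) K
  have h1 : L ^ K ≤ ε₀ / ε := (le_div_iff₀ hε).mpr hK
  have h2 : Real.log (L ^ K) ≤ Real.log (ε₀ / ε) := Real.log_le_log hLK h1
  rw [Real.log_pow] at h2
  rw [le_div_iff₀ hlogL]
  exact h2

/-- **`log(ε₀/ε)/log L < K + 1`** from `ε₀ < L^{K+1}ε` (`L > 1`, `0 < ε ≤ ε₀`): together with `stoppingScale_le_log`,
`K = ⌊log(ε₀/ε)/log L⌋`. PROVED. [cite: Balaban1982Higgs1, (1.2) p.604] -/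
theorem log_lt_stoppingScale_succ {L ε ε₀ : ℝ} (hL : 1 < L) (hε : 0 < ε) (hεε₀ : ε ≤ ε₀) {K : ℕ}
    (hK : ε₀ < L ^ (K + 1) * ε) : Real.log (ε₀ / ε) / Real.log L < (K : ℝ) + 1 := by
  have hlogL : 0 < Real.log L := Real.log_pos hL
  have hq : 0 < ε₀ / ε := div_pos (hε.trans_le hεε₀) hε
  have h1 : ε₀ / ε < L ^ (K + 1) := (div_lt_iff₀ hε).mpr hK
  have h2 : Real.log (ε₀ / ε) < Real.log (L ^ (K + 1)) := Real.log_lt_log hq h1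
  rw [Real.log_pow, Nat.cast_succ] at h2
  rwa [div_lt_iff₀ hlogL]

/-- **`K = O(log ε^{−1})`** as printed (p. 604): for `ε₀ ≤ 1`, `K ≤ log(ε^{−1})/log L`. PROVED.
[cite: Balaban1982Higgs1, (1.2) p.604] -/
theorem stoppingScale_le_log_inv {L ε ε₀ : ℝ} (hL : 1 < L) (hε : 0 < ε) (hε₀ : ε₀ ≤ 1) {K : ℕ}
    (hK : L ^ K * ε ≤ ε₀) : (K : ℝ) ≤ Real.log ε⁻¹ / Real.log L := by
  have hlogL : 0 < Real.log L := Real.log_pos hL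
  have h := stoppingScale_le_log hL hε hK
  have hmono : Real.log (ε₀ / ε) ≤ Real.log ε⁻¹ := by
    have hq : 0 < ε₀ / ε := by
      have : 0 < L ^ K * ε := mul_pos (pow_pos (zero_lt_one.trans hL) K) hε
      exact div_pos (this.trans_le hK) hε
    refine Real.log_le_log hq ?_
    rw [div_eq_mul_inv]
    exact mul_le_of_le_one_left (inv_nonneg.mpr hε.le) hε₀
  exact h.trans (div_le_div_of_nonneg_right hmono hlogL.le)

end Real

/-! ## §3 The same for the predicate `B2.Run.StopsAt` of [Balaban1982Higgs2] (2.116) -/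

section Run

/-- Unfolding of the b2b predicate: `ρ` stops at `ε₀` iff `L^{ρ.K}ρ.ε ≤ ε₀ < L^{ρ.K+1}ρ.ε`. [cite: Balaban1982Higgs2, (2.116) p.582] -/
theorem stopsAt_iff (P : B2.Params) (ε₀ : ℝ) (ρ : B2.Run) :
    ρ.StopsAt P ε₀ ↔ (P.L : ℝ) ^ ρ.K * ρ.ε ≤ ε₀ ∧ ε₀ < (P.L : ℝ) ^ (ρ.K + 1) * ρ.ε :=
  Iff.rfl

/-- **Existence for (2.116)**: for `L > 1` and a run template with `0 < ε ≤ ε₀`, some stopping index `K` makes the run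
stop at `ε₀` (*"The procedure is continued until k = K, where K is such that L^Kε ≦ ε₀, L^{K+1}ε > ε₀"*). PROVED.
[cite: Balaban1982Higgs2, (2.116) p.582] -/
theorem exists_stopsAt (P : B2.Params) (hL : 1 < P.L) {ε₀ : ℝ} (ρ : B2.Run) (hε : 0 < ρ.ε) (hεε₀ : ρ.ε ≤ ε₀) :
    ∃ K : ℕ, ({ ρ with K := K } : B2.Run).StopsAt P ε₀ := by
  have hL' : (1 : ℝ) < (P.L : ℝ) := by exact_mod_cast hL
  obtain ⟨K, hK⟩ := exists_stoppingScale hL' hε hεε₀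
  exact ⟨K, hK⟩

/-- **Uniqueness for (2.116)**: two runs with the same lattice spacing that both stop at `ε₀` have the same `K`. PROVED.
[cite: Balaban1982Higgs2, (2.116) p.582] -/
theorem stopsAt_unique (P : B2.Params) (hL : 1 < P.L) {ε₀ : ℝ} {ρ ρ' : B2.Run} (hε : 0 < ρ.ε) (heq : ρ'.ε = ρ.ε)
    (h : ρ.StopsAt P ε₀) (h' : ρ'.StopsAt P ε₀) : ρ.K = ρ'.K := by
  have hL' : (1 : ℝ) < (P.L : ℝ) := by exact_mod_cast hL
  have h'' : (P.L : ℝ) ^ ρ'.K * ρ.ε ≤ ε₀ ∧ ε₀ < (P.L : ℝ) ^ (ρ'.K + 1) * ρ.ε := by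
    have := (stopsAt_iff P ε₀ ρ').mp h'
    rwa [heq] at this
  exact stoppingScale_unique hL' hε h h''

/-- **`K = O(log ε^{−1})` for (2.116)**: a run that stops at `ε₀` has `K ≤ log(ε₀/ε)/log L`. PROVED.
[cite: Balaban1982Higgs2, (2.116) p.582] -/
theorem stopsAt_le_log (P : B2.Params) (hL : 1 < P.L) {ε₀ : ℝ} {ρ : B2.Run} (hε : 0 < ρ.ε) (h : ρ.StopsAt P ε₀) :
    (ρ.K : ℝ) ≤ Real.log (ε₀ / ρ.ε) / Real.log (P.L : ℝ) := by
  have hL' : (1 : ℝ) < (P.L : ℝ) := by exact_mod_cast hL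
  exact stoppingScale_le_log hL' hε h.1

end Run

end Literature.MathematicalPhysics.QuantumFieldTheory.Balaban1983to89.B1StoppingScale366
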